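import Mathlib
import Summits.ValiantsHypothesis.ValiantsHypothesis.Theorems.GaugeDescentTorusOrbitDescentGalois
import HarnessLib

/-!
# Route GaugeDescent — `DescentGlue` (stmt-ValiantsHypothesis-6637), part C: Galois descent of a
# torus orbit through a GIVEN algebraic point, with the descended point a Laurent MONOMIAL in it

`TorusOrbitDescent` (stmt-6635, `torusOrbitDescent_proof`) produces, for the common zero set
`R = V(S)` covered by the torus orbits of `N` points, a point of `R` over a number field of degree
`≤ N` — but it chooses its own algebraic point of `R` and hides how the descended point is built.
The glue `DescentGlue` needs height control: it starts from Bürgisser's SMALL algebraic point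
`z ∈ R` (Thm. 4.5) and must know that the descended point `y` has coordinates
`y_v = ∏_w z_w^{B v w}` (integer exponents), so that `y` is a unit at every prime where the
non-zero coordinates of `z` are units. This file re-runs the descent with these two changes:

* `exists_monomial_point_over_of_invariants` — the `H¹ = 1` step with the exponent matrix `B`
  exposed (`B v = π(e_v)` for a retraction `π` of `ℤ^ι` onto the kernel lattice of `A`);
* `exists_numberField_monomial_point` — for a given algebraic `z ∈ R`: a number field `K ⊂ ℂ`,
  `[K:ℚ] ≤ N`, and `y ∈ R ∩ K^m` in the orbit of `z` with `y_v = ∏_w z_w^{B v w}` on the support of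
  `z` (and `y_v = 0`, `B v · = 0` off it).

Adapted from `GaugeDescentTorusOrbitDescent.lean` (val-lit p7 g6), whose route-independent helper files
(`…TorusOrbitDescentTorus`, `…TorusOrbitDescentGalois`) are imported.
Honest framing: glue inside a conditional route; `VP ≠ VNP` is NOT proved.

## References

* G. Berhuy, *An Introduction to Galois Cohomology and its Applications* (2010), Thm. III.8.15,
  Prop. III.8.24. [cite: Berhuy2010, Thm. III.8.15]
-/

set_option linter.dupNamespace false

noncomputable section

namespace Summit.ValiantsHypothesis.ValiantsHypothesis.Theorems.GaugeDescent

open Finset MvPolynomial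

namespace DescentGlue

/-! ### §1. The `H¹ = 1` step with exponents exposed -/

section Monomial

variable {ι : Type} [Fintype ι] {k : ℕ}

/-- Rearranging a monomial in monomials: `∏_v (∏_w z_w^{B v w})^{u_v} = ∏_w z_w^{∑_v u_v B v w}`.
[folklore] -/
theorem prod_prod_zpow_zpow (z : ι → ℂˣ) (B : ι → ι → ℤ) (u : ι → ℤ) :
    (∏ v, (∏ w, z w ^ B v w) ^ u v) = ∏ w, z w ^ ∑ v, u v * B v w := by
  calc (∏ v, (∏ w, z w ^ B v w) ^ u v) = ∏ v, ∏ w, z w ^ (B v w * u v) := by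
        refine prod_congr rfl fun v _ => ?_
        rw [← prod_zpow]
        exact prod_congr rfl fun w _ => by rw [← zpow_mul]
    _ = ∏ w, ∏ v, z w ^ (B v w * u v) := prod_comm
    _ = ∏ w, z w ^ ∑ v, u v * B v w := prod_congr rfl fun w _ => by
        rw [zpow_sum']
        exact prod_congr rfl fun v _ => by rw [mul_comm]

/-- **Monomial descent of a torus orbit to the field of its invariants.** Let `z ∈ (ℂˣ)^ι` and
let `K₀ ⊆ ℂ` be a subfield containing every kernel-lattice monomial `∏_v z_v^{u_v}` (`A u = 0`).
Then there is an integer matrix `B` (rows in the kernel lattice: `B v = π(e_v)` for a retraction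
`π : ℤ^ι → ker A`) such that the point `y_v := ∏_w z_w^{B v w}` has all coordinates in `K₀` and lies
in the `T`-orbit of `z`: `y_v = (∏_l t_l^{A l v}) z_v`. (The exponent-exposed form of
`exists_point_over_of_invariants`.) [cite: Berhuy2010, Thm. III.8.15] -/
theorem exists_monomial_point_over_of_invariants [DecidableEq ι] (A : Fin k → ι → ℤ)
    (K₀ : Subfield ℂ) (z : ι → ℂˣ)
    (hinv : ∀ u : ι → ℤ, (∀ l, ∑ v, A l v * u v = 0) → ((∏ v, z v ^ u v : ℂˣ) : ℂ) ∈ K₀) :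
    ∃ (B : ι → ι → ℤ) (t : Fin k → ℂˣ),
      (∀ v l, ∑ w, A l w * B v w = 0) ∧
      (∀ v, (((∏ w, z w ^ B v w : ℂˣ)) : ℂ) ∈ K₀) ∧
      ∀ v, (∏ w, z w ^ B v w) = (∏ l, t l ^ A l v) * z v := by
  -- adapted from GaugeDescentTorusOrbitDescentTorus.lean (`exists_point_over_of_invariants`)
  classical
  let f : (ι → ℤ) →ₗ[ℤ] (Fin k → ℤ) := Matrix.mulVecLin (Matrix.of A)
  have hmemker : ∀ u : ι → ℤ, u ∈ LinearMap.ker f ↔ ∀ l, ∑ v, A l v * u v = 0 := by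
    intro u
    rw [LinearMap.mem_ker, funext_iff]
    exact forall_congr' fun l => by rw [mulVecLin_of_apply, Pi.zero_apply]
  obtain ⟨π, hπ⟩ := exists_retraction_ker f
  let B : ι → ι → ℤ := fun v => ((π (Pi.single v 1) : LinearMap.ker f) : ι → ℤ)
  have hBker : ∀ v, (B v) ∈ LinearMap.ker f := fun v => (π (Pi.single v 1)).2
  have hBA : ∀ v l, ∑ w, A l w * B v w = 0 := fun v => (hmemker _).mp (hBker v)
  -- linearity of `π` in coordinates: `(π u)_w = ∑_v u_v B v w`
  have hπcoord : ∀ u : ι → ℤ, ((π u : LinearMap.ker f) : ι → ℤ) = fun w => ∑ v, u v * B v w := by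
    intro u
    have hsum : u = ∑ v, (u v) • (Pi.single v 1 : ι → ℤ) := by
      funext w
      simp [Finset.sum_apply, Pi.single_apply]
    conv_lhs => rw [hsum, map_sum]
    funext w
    rw [Submodule.coe_sum, Finset.sum_apply]
    refine sum_congr rfl fun v _ => ?_
    rw [map_zsmul, Submodule.coe_smul, Pi.smul_apply, smul_eq_mul]
  refine ⟨B, ?_⟩
  -- `y / z` has trivial kernel-lattice monomials
  obtain ⟨t, ht⟩ := exists_torus_of_kernel_invariants A (fun v => (∏ w, z w ^ B v w) / z v)
    (fun u hu => by
      rw [show (∏ v, ((∏ w, z w ^ B v w) / z v) ^ u v) =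
          (∏ v, (∏ w, z w ^ B v w) ^ u v) / ∏ v, z v ^ u v by
        rw [← prod_div_distrib]; exact prod_congr rfl fun v _ => div_zpow _ _ _]
      rw [prod_prod_zpow_zpow]
      have hu' : u ∈ LinearMap.ker f := (hmemker u).mpr hu
      have hcoord : ∀ w, ∑ v, u v * B v w = u w := fun w => by
        have h1 := congrFun (hπcoord u) w
        rw [show ((π u : LinearMap.ker f) : ι → ℤ) = u from
          congrArg Subtype.val (hπ ⟨u, hu'⟩)] at h1
        exact h1.symm
      rw [prod_congr rfl fun w _ => by rw [hcoord w]]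
      exact div_self' _)
  refine ⟨t, hBA, fun v => hinv (B v) (hBA v), fun v => ?_⟩
  rw [ht v, div_mul_cancel]

end Monomial

/-! ### §2. Descent through a given algebraic point -/


/-- **Galois descent of a torus orbit through a given algebraic point, monomial form.** Let
`R = V(S) ⊂ ℂ^m` (`S ⊂ ℚ[x]`) be the union of the `(ℂˣ)^k`-orbits (weights `A`) of `N ≥ 1` points,
and let `z ∈ R` be a point with algebraic coordinates. Then there are a number field `K ⊂ ℂ` with
`[K:ℚ] ≤ N`, an integer matrix `B` supported on the support of `z`, and a point `y ∈ R ∩ K^m` in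
the orbit of `z` with `y_v = ∏_w z_w^{B v w}` where `z_v ≠ 0` and `y_v = 0` where `z_v = 0`. Proof
as for `torusOrbitDescent_proof`: `Gal(E/ℚ)` (`E` finite Galois containing the `z_v`) permutes
the `≤ N` class functions of points of `R`, the stabiliser `H` of the class function of `z` has
index `≤ N`, the kernel-lattice monomials of `z` lie in `K = E^H`; then
`exists_monomial_point_over_of_invariants`. [cite: Berhuy2010, Thm. III.8.15] -/
theorem exists_numberField_monomial_point (m k N : ℕ) (S : Set (MvPolynomial (Fin m) ℚ))
    (A : Fin k → Fin m → ℤ) (pts : Fin N → Fin m → ℂ)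
    (H1 : ∀ (i : Fin N) (t : Fin k → ℂˣ), ∀ f ∈ S,
      aeval (fun v => ((∏ l, t l ^ A l v : ℂˣ) : ℂ) * pts i v) f = 0)
    (H2 : ∀ y : Fin m → ℂ, (∀ f ∈ S, aeval y f = 0) →
      ∃ (i : Fin N) (t : Fin k → ℂˣ), ∀ v, y v = ((∏ l, t l ^ A l v : ℂˣ) : ℂ) * pts i v)
    (z : Fin m → ℂ) (hzalg : ∀ v, IsAlgebraic ℚ (z v)) (hzR : ∀ f ∈ S, aeval z f = 0) :
    ∃ (K : IntermediateField ℚ ℂ) (y : Fin m → ℂ) (B : Fin m → Fin m → ℤ) (t : Fin k → ℂˣ),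
      FiniteDimensional ℚ K ∧ Module.finrank ℚ K ≤ N ∧ (∀ v, y v ∈ K) ∧
      (∀ f ∈ S, aeval y f = 0) ∧ (∀ v, y v = ((∏ l, t l ^ A l v : ℂˣ) : ℂ) * z v) ∧
      (∀ v w, z w = 0 → B v w = 0) ∧ (∀ v, z v = 0 → y v = 0) ∧
      (∀ v, z v ≠ 0 → y v = ∏ w, z w ^ B v w) := by
  -- adapted from GaugeDescentTorusOrbitDescent.lean (`torusOrbitDescent_proof`, val-lit p7 g6)
  classical
  obtain ⟨E, hEfd, hEgal, hzE⟩ := exists_galois_intermediateField z hzalg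
  let zE : Fin m → E := fun v => ⟨z v, hzE v⟩
  have hzE0 : ∀ v, zE v = 0 ↔ z v = 0 := fun v => by
    rw [← ZeroMemClass.coe_eq_zero]
  have haevalE : ∀ (ψ : E →ₐ[ℚ] ℂ) (f : MvPolynomial (Fin m) ℚ),
      aeval (fun v => ψ (zE v)) f = ψ (aeval zE f) := fun ψ f => by
    rw [MvPolynomial.comp_aeval_apply]
  have hzER : ∀ f ∈ S, aeval zE f = 0 := by
    intro f hf
    have h := haevalE (IntermediateField.val E) f
    have h' : aeval (fun v => (IntermediateField.val E) (zE v)) f = aeval z f := rfl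
    have h2 : (((aeval zE f : E)) : ℂ) = 0 := h.symm.trans (h'.trans (hzR f hf))
    exact ZeroMemClass.coe_eq_zero.mp h2
  -- every Galois conjugate of `z` lies in `R`
  have hconjR : ∀ σ : E ≃ₐ[ℚ] E, ∀ f ∈ S, aeval (fun v => ((σ (zE v) : E) : ℂ)) f = 0 := by
    intro σ f hf
    have h := haevalE ((IntermediateField.val E).comp (σ : E →ₐ[ℚ] E)) f
    rw [hzER f hf, map_zero] at h
    exact h
  -- the class function of `z` and its stabiliser
  let c : Fin m ⊕ (Fin m → ℤ) → E := classFun A zE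
  let H : Subgroup (E ≃ₐ[ℚ] E) := MulAction.stabilizer (E ≃ₐ[ℚ] E) c
  have horb : ∀ x ∈ MulAction.orbit (E ≃ₐ[ℚ] E) c,
      ∃ i : Fin N, (fun w => ((x w : E) : ℂ)) = classFun A (pts i) := by
    rintro x ⟨σ, rfl⟩
    obtain ⟨i, t, hit⟩ := H2 (fun v => ((σ (zE v) : E) : ℂ)) (hconjR σ)
    refine ⟨i, ?_⟩
    have hx : (fun w => (((σ • c) w : E) : ℂ)) = classFun A (fun v => ((σ (zE v) : E) : ℂ)) := by
      have h1 : σ • c = classFun A (fun v => σ (zE v)) := smul_classFun A E σ zE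
      rw [h1]
      exact coe_classFun A E _
    rw [hx, show (fun v => ((σ (zE v) : E) : ℂ)) =
      fun v => ((∏ l, t l ^ A l v : ℂˣ) : ℂ) * pts i v from funext hit]
    exact classFun_torus A (pts i) t
  choose Ψ hΨ using horb
  have hcard : (MulAction.orbit (E ≃ₐ[ℚ] E) c).ncard ≤ N := by
    rw [← Nat.card_coe_set_eq]
    have hinj : Function.Injective (fun x : MulAction.orbit (E ≃ₐ[ℚ] E) c => Ψ x.1 x.2) := by
      intro x x' hxx'
      apply Subtype.ext
      funext w
      have h1 := hΨ x.1 x.2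
      have h2 := hΨ x'.1 x'.2
      simp only at hxx'
      rw [hxx', ← h2] at h1
      exact Subtype.ext (congrFun h1 w)
    simpa using Nat.card_le_card_of_injective _ hinj
  have hindex : H.index ≤ N := by
    rw [MulAction.index_stabilizer]
    exact hcard
  -- the fixed field `K₀ = E^H`, of degree `[G:H] ≤ N` over `ℚ`
  let K₀ : IntermediateField ℚ E := IntermediateField.fixedField H
  have hK₀ : Module.finrank ℚ K₀ ≤ N := by
    have h1 : Module.finrank K₀ E = Nat.card H := IntermediateField.finrank_fixedField_eq_card H
    have h2 : Nat.card (E ≃ₐ[ℚ] E) = Module.finrank ℚ E := IsGalois.card_aut_eq_finrank ℚ E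
    have h3 := Module.finrank_mul_finrank ℚ K₀ E
    have h4 := H.card_mul_index
    have hH : 0 < Nat.card H := Nat.card_pos
    have : Module.finrank ℚ K₀ = H.index := by
      apply Nat.eq_of_mul_eq_mul_left hH
      calc Nat.card H * Module.finrank ℚ K₀ = Module.finrank ℚ K₀ * Module.finrank K₀ E := by
            rw [h1, mul_comm]
        _ = Nat.card H * H.index := by rw [h3, ← h2, h4]
    rw [this]
    exact hindex
  -- the kernel-lattice monomials of `z` lie in `K₀`
  have hinvK₀ : ∀ u : Fin m → ℤ, (∀ v, z v = 0 → u v = 0) → (∀ l, ∑ v, A l v * u v = 0) →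
      (∏ v, zE v ^ u v) ∈ K₀ := by
    intro u hu hA
    have hu' : ∀ v, zE v = 0 → u v = 0 := fun v hv => hu v ((hzE0 v).mp hv)
    rw [IntermediateField.mem_fixedField_iff]
    intro σ hσ
    have hσc : σ • c = c := MulAction.mem_stabilizer_iff.mp hσ
    have := congrFun hσc (Sum.inr u)
    rw [Pi.smul_apply, AlgEquiv.smul_def] at this
    rwa [show c (Sum.inr u) = ∏ v, zE v ^ u v from classFun_inr_of A zE hu' hA] at this
  -- monomial descent of the orbit of `z` to `K₀` (on the support of `z`)
  let ι := {v : Fin m // z v ≠ 0}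
  let K₁ : IntermediateField ℚ ℂ := IntermediateField.lift K₀
  have hmemK₁ : ∀ x : E, x ∈ K₀ → (x : ℂ) ∈ K₁ := fun x hx =>
    (IntermediateField.mem_lift x).mpr hx
  let zι : ι → ℂˣ := fun i => Units.mk0 (z i) i.2
  -- sums and products of functions supported on the support of `z`
  have hsum : ∀ g : Fin m → ℤ, (∀ v, z v = 0 → g v = 0) → ∑ v, g v = ∑ i : ι, g i := by
    intro g hg
    calc ∑ v, g v = ∑ v ∈ univ.filter (fun v => z v ≠ 0), g v :=
          (Finset.sum_filter_of_ne (s := univ) (p := fun v => z v ≠ 0)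
            (fun v _ hgv => fun hzv => hgv (hg v hzv))).symm
      _ = ∑ i : ι, g i := Finset.sum_subtype _ (fun v => by simp) g
  have hprodz : ∀ u : Fin m → ℤ, (∀ v, z v = 0 → u v = 0) →
      (((∏ i : ι, zι i ^ u i : ℂˣ)) : ℂ) = ∏ v, z v ^ u v := by
    intro u hu0
    have hl : (((∏ i : ι, zι i ^ u i : ℂˣ)) : ℂ) = ∏ i : ι, z i ^ u i := by
      rw [Units.coe_prod]
      exact prod_congr rfl fun i _ => by rw [Units.val_zpow_eq_zpow_val, Units.val_mk0]
    rw [hl]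
    symm
    calc ∏ v, z v ^ u v = ∏ v ∈ univ.filter (fun v => z v ≠ 0), z v ^ u v := by
          refine (Finset.prod_filter_of_ne (s := univ) (p := fun v => z v ≠ 0)
            (fun v _ hv => fun hzv => hv ?_)).symm
          rw [hu0 v hzv, zpow_zero]
      _ = ∏ i : ι, z i ^ u i := Finset.prod_subtype _ (fun v => by simp) _
  obtain ⟨B', t, hB'A, hB'K, hB't⟩ := exists_monomial_point_over_of_invariants (ι := ι)
    (fun l i => A l i) K₁.toSubfield zι (by
      intro u' hu'
      -- extend `u'` by zero off the support of `z`
      let u : Fin m → ℤ := fun v => if h : z v ≠ 0 then u' ⟨v, h⟩ else 0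
      have hu0 : ∀ v, z v = 0 → u v = 0 := fun v hv => by simp [u, hv]
      have hA : ∀ l, ∑ v, A l v * u v = 0 := by
        intro l
        rw [hsum (fun v => A l v * u v) (fun v hv => by simp [hu0 v hv])]
        rw [← hu' l]
        exact sum_congr rfl fun i _ => by simp [u, i.2]
      have hprod : (((∏ i : ι, zι i ^ u' i : ℂˣ)) : ℂ) = (((∏ v, zE v ^ u v : E)) : ℂ) := by
        have hr : (((∏ v, zE v ^ u v : E)) : ℂ) = ∏ v, z v ^ u v := by
          change algebraMap E ℂ (∏ v, zE v ^ u v) = _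
          rw [map_prod]
          exact prod_congr rfl fun v _ => by rw [map_zpow₀]; rfl
        rw [hr, ← hprodz u hu0]
        congr 1
        refine prod_congr rfl fun (i : ι) _ => ?_
        simp [u, i.2]
      rw [IntermediateField.mem_toSubfield, hprod]
      exact hmemK₁ _ (hinvK₀ u hu0 hA))
  -- the exponent matrix, extended by zero, and the point `y`
  let B : Fin m → Fin m → ℤ := fun v w =>
    if hv : z v ≠ 0 then (if hw : z w ≠ 0 then B' ⟨v, hv⟩ ⟨w, hw⟩ else 0) else 0
  let y : Fin m → ℂ := fun v => if h : z v ≠ 0 then (((∏ j : ι, zι j ^ B' ⟨v, h⟩ j : ℂˣ)) : ℂ) else 0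
  have hB0 : ∀ v w, z w = 0 → B v w = 0 := fun v w hw => by
    simp only [B, hw, ne_eq, not_true_eq_false, dif_neg, not_false_eq_true, dite_eq_ite,
      ite_self]
  have hymon : ∀ v (hv : z v ≠ 0), y v = ∏ w, z w ^ B v w := by
    intro v hv
    simp only [y, dif_pos hv]
    rw [← hprodz (B v) (hB0 v)]
    congr 1
    refine prod_congr rfl fun (j : ι) _ => ?_
    simp [B, hv, j.2]
  have hyz : ∀ v, y v = ((∏ l, t l ^ A l v : ℂˣ) : ℂ) * z v := by
    intro v
    by_cases h : z v ≠ 0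
    · simp only [y, dif_pos h]
      rw [hB't ⟨v, h⟩, Units.val_mul, Units.val_mk0]
    · rw [not_not] at h
      simp [y, h]
  -- `y` lies in the orbit of `z`, hence in `R`
  obtain ⟨i₀, t₀, hzt₀⟩ := H2 z hzR
  have hyR : ∀ f ∈ S, aeval y f = 0 := by
    intro f hf
    have hy : y = fun v => ((∏ l, (t l * t₀ l) ^ A l v : ℂˣ) : ℂ) * pts i₀ v := by
      funext v
      have hw : (∏ l, (t l * t₀ l) ^ A l v) = (∏ l, t l ^ A l v) * ∏ l, t₀ l ^ A l v := by
        rw [← prod_mul_distrib]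
        exact prod_congr rfl fun l _ => mul_zpow _ _ _
      rw [hyz v, hzt₀ v, hw, Units.val_mul, mul_assoc]
    rw [hy]
    exact H1 i₀ (fun l => t l * t₀ l) f hf
  refine ⟨K₁, y, B, t, ?_, ?_, ?_, hyR, hyz, hB0, ?_, hymon⟩
  · exact LinearEquiv.finiteDimensional (IntermediateField.liftAlgEquiv K₀).toLinearEquiv
  · rw [← (IntermediateField.liftAlgEquiv K₀).toLinearEquiv.finrank_eq]
    exact hK₀
  · intro v
    by_cases h : z v ≠ 0
    · simp only [y, dif_pos h]
      exact hB'K ⟨v, h⟩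
    · simp only [y, dif_neg h]
      exact K₁.zero_mem
  · intro v hv
    simp only [y, hv, ne_eq, not_true_eq_false, not_false_eq_true, dif_neg]

end DescentGlue

end Summit.ValiantsHypothesis.ValiantsHypothesis.Theorems.GaugeDescent

end
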